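import Literature.IUT.HodgeTheaters.GlobalFrobenioidsCyclotomes
import Literature.IUT.HodgeTheaters.GlobalFrobenioidsCyclotomeRigidityZHat
import HarnessLib

/-!
# [IUTchI] Example 5.1 (v), p. 128: "there exists a UNIQUE isomorphism of cyclotomes
# `μ^Θ_Ẑ(π₁(†𝒟^⊚)) ⥲ μ_Ẑ(†𝕄^⊛_∞κ)` such that … induces an isomorphism `𝕄^⊛_∞κ(†𝒟^⊚) ⥲ †𝕄^⊛_∞κ`"
# — DERIVED, in abc-iut-L5-t1's `CyclotomeComparison` vocabulary, from the printed inputs typed as laws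

S. Mochizuki, *Inter-universal Teichmüller theory I*, kurims manuscript (May 2020), §5, Example 5.1 (v)
p. 127 l. 75 – p. 128 l. 12 ([IUTchI] Ex 5.1 (v) pp.127–128) [claim: Mochizuki2012, status: disputed]:
"it follows immediately, by considering divisors of zeroes and poles [cf. the definition of a "`κ`-coric
function" given in Remark 3.1.7, (i)] associated to Kummer classes of rational functions as in [AbsTopIII],
Proposition 1.6, (iii), from the elementary observation that, relative to the natural inclusion
`ℚ ↪ Ẑ ⊗ ℚ`, `ℚ_{>0} ∩ Ẑ^× = {1}`, that there exists a unique isomorphism of cyclotomes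
`μ^Θ_Ẑ(π₁(†𝒟^⊚)) ⥲ μ_Ẑ(†𝕄^⊛_∞κ)` (respectively, `… ⥲ μ_Ẑ(†𝕄^⊛_∞κ×)`) such that the resulting isomorphism
between direct limits of cohomology modules as considered above induces an isomorphism
`𝕄^⊛_∞κ(†𝒟^⊚) ⥲ †𝕄^⊛_∞κ` (respectively, `𝕄^⊛_∞κ×(†𝒟^⊚) ⥲ †𝕄^⊛_∞κ×`)"; second display p. 128 l. 13–24 (the
`†𝕄^⊛` case, three layers `⊛ / sol / mod`, "compatible with the integral submonoids `𝒪^⊿_𝔭`").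

Cell abc-iut, sub-DAG `plan/L5/SUBDAG-IUTchI-Ex51.md` rows E51/L27 (both sub-rows (a) existence / (b)
uniqueness) and E51/L28 (index seat abc-iut-w5-d110); FACT-LIST F-2582 `UniqueCyclotomeIso` (a SCHEMA over
abc-iut-L5-t1's free data `CyclotomeComparison` — "consumable at named instances only",
`GlobalFrobenioidsCyclotomesNonVacuity.lean`) and F-2577 `UniqueCyclotomeIsoFamily`.  Sibling of
`GlobalFrobenioidsCoricRigidityOfLaws.lean` (the same argument in the coric-PAIR vocabulary of E51/L29).

## What is proved (theorems only; the printed inputs are EXPLICIT HYPOTHESES in Lean-signature form, no def)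

Over a comparison datum `C` (two cyclotomes `μ₁, μ₂`, two Kummer containers `H₁, H₂`, images `im₁, im₂`,
and the container map `C.induced e` of a cyclotome isomorphism `e`), with `Ẑ^× = Aut(Ẑ)` acting on the
cyclotome isomorphisms (`zμ`, "`Aut(μ_Ẑ) = Ẑ^×`") and on the target container (`twist`), unit laws only:

* `UniqueCyclotomeIso.of_laws` — **E51/L27**: from
  (E) EXISTENCE of one cyclotome isomorphism whose container map carries `im₁` bijectively onto `im₂` [the
  structure isomorphism `𝕄^⊛_∞κ(†𝒟^⊚) ⥲ †𝕄^⊛_∞κ`; sub-row (a)],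
  (T) TORSOR + FUNCTORIALITY: any two cyclotome isomorphisms differ by a unit `u ∈ Ẑ^×`, `e′ = zμ u e`, and
  then `induced e′ = twist u ∘ induced e` [functoriality of `lim_H H¹(H, −)` in the coefficients],
  (D) DIVISOR TRANSPORT on `im₂` [[AbsTopIII] Prop. 1.6 (iii): a unit `u` preserving the Kummer classes of
  `†𝕄^⊛_∞κ` multiplies their integer divisors, `u(ord_x h) = ord_x(u·h)` in `Ẑ`], and
  Rmk 3.1.7 (i)/(ii) on `im₂` [some class has two distinct zeroes; every class has at most one pole],
  the printed `∃!` holds — "`ℚ_{>0} ∩ Ẑ^× = {1}`" (abc-iut-w4-d056's `CyclotomeRigidity.eq_one_of_two_zeros_one_pole`,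
  over abc-iut-w5-d110's exponent engine) forces `u = 1`;
* `UniqueCyclotomeIsoFamily.of_laws` — **E51/L28** (the `†𝕄^⊛` display with layers and `𝒪^⊿_𝔭`): the
  family statement from the same laws at ONE layer plus the existence of an isomorphism satisfying the whole
  such-that clause (abc-iut-L5-t12's `UniqueCyclotomeIsoFamily.of_component`).

HONEST FRAMING: (E), (T), (D) and the Rmk 3.1.7 clauses are typed, not proved — interface laws of the
Kummer-map / [AbsTopIII] Thm 1.9 merge (GAP-LEDGER G-w4d056-2 family); nothing here asserts a disputed
claim or takes a side on [IUTchIII] Cor. 3.12; typed ≠ proved.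
-/

namespace Literature.IUT.HodgeTheaters

open ProfiniteGrp ProfiniteGrp.ProfiniteCompletion
open Literature.AnabelianGeometry.EtaleTheta Literature.AnabelianGeometry.EtaleTheta.ZHatLevel

universe u v w w'

/-! ### E51/L27: the one-layer display -/

/-- **Ex. 5.1 (v), p. 128 l. 1–12 — `UniqueCyclotomeIso C` FROM THE PRINTED INPUTS.**  Let `C` be
abc-iut-L5-t1's comparison datum, `zμ` an action of `Ẑ^× = Aut(Ẑ)` on the cyclotome isomorphisms `μ₁ ⥲ μ₂`
and `twist` one on the target container `H₂`, with `zμ 1 = id` (no law on `twist` is needed here).  Suppose: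
(E) some `e₀ : μ₁ ⥲ μ₂` induces a bijection `im₁ ⥲ im₂` [the structure isomorphism of (v)];
(T) for all `e, e′` there is `u ∈ Ẑ^×` with `e′ = zμ u e` and `induced e′ = twist u ∘ induced e`
["`Aut(μ_Ẑ) = Ẑ^×`" and functoriality of the direct limits of cohomology modules in the coefficients];
(D) a unit `u` whose container action preserves `im₂` transports the orders of the classes in `im₂`,
`u(ord_x h) = ord_x(twist u h)` in `Ẑ` [[AbsTopIII] Prop. 1.6 (iii)];
(Rmk 3.1.7 (i)/(ii)) some class in `im₂` has two distinct zeroes, every class in `im₂` has at most one pole.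
Then there is EXACTLY ONE cyclotome isomorphism inducing `im₁ ⥲ im₂`.
([IUTchI] Ex 5.1 (v) p.128) [claim: Mochizuki2012, status: disputed] -/
theorem UniqueCyclotomeIso.of_laws (C : CyclotomeComparison.{u})
    (zμ : MulAut (completion (GrpCat.of (Multiplicative ℤ))) → (C.μ₁ ≃* C.μ₂) → (C.μ₁ ≃* C.μ₂))
    (hzμ_one : ∀ e, zμ 1 e = e)
    (twist : MulAut (completion (GrpCat.of (Multiplicative ℤ))) → C.H₂ → C.H₂)
    (hex : ∃ e₀ : C.μ₁ ≃* C.μ₂, Set.BijOn (C.induced e₀) C.im₁ C.im₂)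
    (htors : ∀ e e' : C.μ₁ ≃* C.μ₂, ∃ u : MulAut (completion (GrpCat.of (Multiplicative ℤ))),
      e' = zμ u e ∧ ∀ h, C.induced e' h = twist u (C.induced e h))
    {Pt : Type v} (ord : Pt → C.H₂ → ℤ)
    (hord : ∀ u : MulAut (completion (GrpCat.of (Multiplicative ℤ))), Set.MapsTo (twist u) C.im₂ C.im₂ →
      ∀ h ∈ C.im₂, ∀ x : Pt, u (eta (ord x h)) = eta (ord x (twist u h)))
    (htwo : ∃ h ∈ C.im₂, ∃ x₁ x₂ : Pt, x₁ ≠ x₂ ∧ 0 < ord x₁ h ∧ 0 < ord x₂ h)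
    (hone : ∀ h ∈ C.im₂, ∀ x₁ x₂ : Pt, x₁ ≠ x₂ → ¬ (ord x₁ h < 0 ∧ ord x₂ h < 0)) :
    UniqueCyclotomeIso C := by
  obtain ⟨e₀, he₀⟩ := hex
  refine ⟨⟨e₀, he₀, fun e he => ?_⟩⟩
  -- `e` and `e₀` differ by a unit `u`, the induced maps by its container action
  obtain ⟨u, hue, hu⟩ := htors e₀ e
  -- `twist u` preserves `im₂`: every `h ∈ im₂` is `induced e₀ h₁` with `h₁ ∈ im₁`, and
  -- `twist u (induced e₀ h₁) = induced e h₁ ∈ im₂`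
  have hmaps : Set.MapsTo (twist u) C.im₂ C.im₂ := by
    intro h hh
    obtain ⟨h₁, hh₁, rfl⟩ := he₀.surjOn hh
    rw [← hu h₁]
    exact he.mapsTo hh₁
  -- divisors: "`ℚ_{>0} ∩ Ẑ^× = {1}`" forces `u = 1`
  obtain ⟨h, hh, x₁, x₂, hne, h₁, h₂⟩ := htwo
  have hu1 : u = 1 :=
    CyclotomeRigidity.eq_one_of_two_zeros_one_pole u h₁ h₂ (hone (twist u h) (hmaps hh) x₁ x₂ hne)
      (hord u hmaps h hh x₁) (hord u hmaps h hh x₂)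
  rw [hue, hu1, hzμ_one]

/-- Under the same laws the container maps of ANY two cyclotome isomorphisms inducing `im₁ ⥲ im₂` agree
(the weaker, container-level form of the uniqueness, independent of the `zμ`-bookkeeping).
([IUTchI] Ex 5.1 (v) p.128) [claim: Mochizuki2012, status: disputed] -/
theorem CyclotomeComparison.induced_eq_of_laws (C : CyclotomeComparison.{u})
    (twist : MulAut (completion (GrpCat.of (Multiplicative ℤ))) → C.H₂ → C.H₂)
    (htwist_one : ∀ h, twist 1 h = h)
    (htors : ∀ e e' : C.μ₁ ≃* C.μ₂, ∃ u : MulAut (completion (GrpCat.of (Multiplicative ℤ))),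
      ∀ h, C.induced e' h = twist u (C.induced e h))
    {Pt : Type v} (ord : Pt → C.H₂ → ℤ)
    (hord : ∀ u : MulAut (completion (GrpCat.of (Multiplicative ℤ))), Set.MapsTo (twist u) C.im₂ C.im₂ →
      ∀ h ∈ C.im₂, ∀ x : Pt, u (eta (ord x h)) = eta (ord x (twist u h)))
    (htwo : ∃ h ∈ C.im₂, ∃ x₁ x₂ : Pt, x₁ ≠ x₂ ∧ 0 < ord x₁ h ∧ 0 < ord x₂ h)
    (hone : ∀ h ∈ C.im₂, ∀ x₁ x₂ : Pt, x₁ ≠ x₂ → ¬ (ord x₁ h < 0 ∧ ord x₂ h < 0))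
    {e₀ e : C.μ₁ ≃* C.μ₂} (he₀ : Set.BijOn (C.induced e₀) C.im₁ C.im₂)
    (he : Set.BijOn (C.induced e) C.im₁ C.im₂) : ∀ h, C.induced e h = C.induced e₀ h := by
  obtain ⟨u, hu⟩ := htors e₀ e
  have hmaps : Set.MapsTo (twist u) C.im₂ C.im₂ := by
    intro h hh
    obtain ⟨h₁, hh₁, rfl⟩ := he₀.surjOn hh
    rw [← hu h₁]
    exact he.mapsTo hh₁
  obtain ⟨h, hh, x₁, x₂, hne, h₁, h₂⟩ := htwo
  have hu1 : u = 1 :=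
    CyclotomeRigidity.eq_one_of_two_zeros_one_pole u h₁ h₂ (hone (twist u h) (hmaps hh) x₁ x₂ hne)
      (hord u hmaps h hh x₁) (hord u hmaps h hh x₂)
  intro h'
  rw [hu h', hu1, htwist_one]

/-! ### E51/L28: the `†𝕄^⊛` display (layers `⊛ / sol / mod`, integral submonoids `𝒪^⊿_𝔭`) -/

/-- **Ex. 5.1 (v), p. 128 l. 13–24 — `UniqueCyclotomeIsoFamily C` FROM THE PRINTED INPUTS** ("it follows
immediately from the theory summarized in [AbsTopIII], Theorem 1.9, (d), that there exists a unique
isomorphism of cyclotomes `μ^Θ_Ẑ(π₁(†𝒟^⊚)) ⥲ μ_Ẑ(†𝕄^⊛)` such that … induces isomorphisms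
`𝕄^⊛(†𝒟^⊚) ⥲ †𝕄^⊛`, `𝕄^⊛_sol(†𝒟^⊚) ⥲ †𝕄^⊛_sol`, `𝕄^⊛_mod(†𝒟^⊚) ⥲ †𝕄^⊛_mod` … compatible with the integral
submonoids `𝒪^⊿_𝔭`"): the laws (T), (D) and Rmk 3.1.7 (i)/(ii) at ONE layer `i₀` [e.g. `⊛`, the Kummer classes of
`F̄^×`-valued rational functions] together with the existence of an isomorphism satisfying the WHOLE
such-that clause give the family `∃!` (abc-iut-L5-t12's `UniqueCyclotomeIsoFamily.of_component`).
([IUTchI] Ex 5.1 (v) p.128) [claim: Mochizuki2012, status: disputed] -/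
theorem UniqueCyclotomeIsoFamily.of_laws {ι : Type w} {𝔓 : Type w'} (C : CyclotomeComparisonFamily ι 𝔓)
    (i₀ : ι)
    (zμ : MulAut (completion (GrpCat.of (Multiplicative ℤ))) → (C.μ₁ ≃* C.μ₂) → (C.μ₁ ≃* C.μ₂))
    (hzμ_one : ∀ e, zμ 1 e = e)
    (twist : MulAut (completion (GrpCat.of (Multiplicative ℤ))) → C.H₂ → C.H₂)
    (hex : ∃ e, C.InducesCompatibleIsos e)
    (htors : ∀ e e' : C.μ₁ ≃* C.μ₂, ∃ u : MulAut (completion (GrpCat.of (Multiplicative ℤ))),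
      e' = zμ u e ∧ ∀ h, C.induced e' h = twist u (C.induced e h))
    {Pt : Type v} (ord : Pt → C.H₂ → ℤ)
    (hord : ∀ u : MulAut (completion (GrpCat.of (Multiplicative ℤ))),
      Set.MapsTo (twist u) (C.im₂ i₀) (C.im₂ i₀) →
        ∀ h ∈ C.im₂ i₀, ∀ x : Pt, u (eta (ord x h)) = eta (ord x (twist u h)))
    (htwo : ∃ h ∈ C.im₂ i₀, ∃ x₁ x₂ : Pt, x₁ ≠ x₂ ∧ 0 < ord x₁ h ∧ 0 < ord x₂ h)
    (hone : ∀ h ∈ C.im₂ i₀, ∀ x₁ x₂ : Pt, x₁ ≠ x₂ → ¬ (ord x₁ h < 0 ∧ ord x₂ h < 0)) :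
    UniqueCyclotomeIsoFamily C := by
  refine UniqueCyclotomeIsoFamily.of_component C i₀ ?_ hex
  obtain ⟨e, he⟩ := hex
  exact UniqueCyclotomeIso.of_laws (C.component i₀) zμ hzμ_one twist ⟨e, he.1 i₀⟩ htors ord
    hord htwo hone

end Literature.IUT.HodgeTheaters
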